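import Summits.BirchSwinnertonDyer.BirchSwinnertonDyer.Theses.GenusKolyvaginAtTwo
import Summits.BirchSwinnertonDyer.BirchSwinnertonDyer.Theorems.GenusKolyvaginAtTwoMinimalTwinBSDTwoConverseSupplies
import Summits.BirchSwinnertonDyer.BirchSwinnertonDyer.Theorems.GenusKolyvaginAtTwoMinimalTwinBSDTwoAllDepthCells
import Summits.BirchSwinnertonDyer.BirchSwinnertonDyer.Theorems.GenusKolyvaginAtTwoMinimalTwinBSDTwoEggAllImages
import Summits.BirchSwinnertonDyer.BirchSwinnertonDyer.Theorems.GenusKolyvaginAtTwoMinimalTwinBSDTwoIdentityDoorCellsExp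
import Summits.BirchSwinnertonDyer.BirchSwinnertonDyer.Theorems.GenusKolyvaginAtTwoMinimalTwinBSDTwoIdentityDoorSupplyAllImages
import Summits.BirchSwinnertonDyer.Rank1Residual.F1Sign2.DescentSignAtTwo
import HarnessLib

/-!
# LINE 23 «twin_swap» v2.2 (= v2.1 with the identity-locus stub in EXP-SHAPE: `KEX_id` ↦ `EXP_id` «`2^{ord₂ c + ord₂ C(W) + 1} ∥ P(1)`», its
# `Ш`-factor `#Ш(W_K)[2^∞] = 4` now a THEOREM) on crux hTw `MinimalTwinBSDTwo` (stmt-BirchSwinnertonDyer-22985, route `GenusKolyvaginAtTwo` rev 59)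

Prepared by seat `bsd-line-gk2-p3` g33 (PROVER 3/3, cell bsd-f1-sign2), 2026-08-30, as a TURNKEY variant of the LINE 23 holder's v2.1
(`bsd-line-gk2-p2` g26, `Lines/twin_swap.lean` v2.0 / HOME `line22985/twin_swap_v21_gk2p2.lean`); the holder decides whether to register it.
Nothing here proves BSD, U₂, the wall, the converses, the supplies or the exponents.

WHAT CHANGED vs v2.1.  ONE stub changes SHAPE, nothing else: on the `Δ > 0` identity locus the v2.0/v2.1 stub KEX_id asked for SOME exact depth
`2^{M₀} ∥ P(1)` with `#Ш(W_K)[2^∞] · 4^{ord₂ c + ord₂ C(W)} = 4^{M₀}` («BSD predicts `#Ш(W_K)[2^∞] = 4`»).  gk2-p3 g33's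
`IdentityDoorSha.natCard_selmerGroup_baseChange_eq_eight_and_sha_of_identityDoor` (p783059 + `…IdentityDoorCellsExp`) PROVES `#Sel₂(W_K) = 8`,
`#Ш(W_K)[2] = #Ш(W_K)[2^∞] = 4` UNCONDITIONALLY at every identity-prime door (Kramer Thm 1 at the identity prime: descent off `{∞, ℓ}`, gk2-p2's
two-place count, gk2-p5's `σ−1 ≡ 0 mod κ(W(K))`, Cassels–Tate, gk2-p4's one-bit law), so KEX_id ⟺ **EXP_id: «`2^{ord₂ c + ord₂ C(W) + 1} ∥ P(1)`»**
(LOSSLESS: `IdentityDoorSha.twoDivExponent_eq_succ_of_bsdp_of_identityDoor`), and the identity-locus engine becomes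
`IdentityDoorSha.bsdp_posDisc_offEgg_of_wall_of_converse_of_idSupply_of_expId_of_facts_allImages`.  So (v2.2): **hTw ⟸ WALL row 1 + CONV₀ (19218 +
19219 + off-semistable residual) + EXP⁻_all + EXP⁺_all + EXP_id + PRINT×5**, SEVEN stubs, the three exponent stubs of ONE shape «`2^{e} ∥ P(1)`»
(`e = ord₂ c + ord₂ C(W)` on `Δ < 0` and on the egg, `e + 1` on the identity locus — the identity door's capitulation defect `Ш(W_K)[2] = (ℤ/2)²`
costs exactly one bit of Heegner depth); IDSUPPLY closed by name; sorry-free outside the stubs; no residual locus.  v2.1's text follows unchanged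
except for the stub.  BSD is NOT proved by any of this.

(v2.1 header, gk2-p2 g26:) # LINE 23 «twin_swap» v2.1 (THE IDENTITY-PRIME DOOR, ALL IMAGES: the whole `Δ > 0` off-egg locus is «wall + converse + identity-door supply +
# exactness-shaped exponent»; NO declared residual locus) on crux hTw `MinimalTwinBSDTwo` (stmt-BirchSwinnertonDyer-22985, route `GenusKolyvaginAtTwo` rev 59)

Seat `bsd-line-gk2-p2` g26 (PROVER 2/3, cell bsd-f1-sign2, LINE 23 holder), 2026-08-30, on top of v2.0 (this seat, same day).  Nothing here proves BSD, U₂,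
the wall, the converses, the supplies or the exponents.

WHAT CHANGED vs v2.0.  v2.0's identity door needed `ρ̄_{W,2}` onto (the two-class key lemma used `End_Γ(E[2]) = 𝔽₂`) and declared the residual
OFF‴ = `Δ > 0 ∧ ¬ρ̄₂ onto ∧ ¬MeetsEgg` (square discriminant, identity locus).  The key lemma's translate-avoiding form holds for EVERY curve with
`E(ℚ)[2] = 0` (image `S₃` OR `C₃`; `IdentityDoor.exists_torsionFixing_fix_h1Eval_translate_of_noFixed`, a count `3 < 4` on the attained subgroup of
`E[2]²`), and on U₂ `E(ℚ)[2] = 0` is forced by rank `1` + `#Sel₂ = 2`; so the Čebotarev step, the supply (`IdentityDoor.identityDoorSupplyAtTwo_allImages_of_GZK`,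
a THEOREM mod GZK) and the cell engine (`IdentityDoor.bsdp_posDisc_offEgg_of_wall_of_converse_of_idSupply_of_kex_of_facts_allImages`) lose the image
hypothesis, KEX_id loses its `ρ̄₂ onto` binder, and **OFF‴ is DELETED**: the composition is the exhaustive trichotomy `Δ < 0` (AllDepth) ∨ `Δ > 0 ∧ MeetsEgg`
(EggAllImages) ∨ `Δ > 0 ∧ ¬MeetsEgg` (identity door).  So (v2.1): **hTw ⟸ WALL row 1 + CONV₀ (19218 + 19219 + off-semistable residual) + EXP⁻_all +
EXP⁺_all + KEX_id + PRINT×5**, SEVEN stubs — every one an existing item (WALL, CONV₀ ×2, PRINT), the declared CONV₀ residual, or the BSD₂ content in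
lossless Kolyvagin-divisibility/exactness form (EXP⁻_all, EXP⁺_all, KEX_id); IDSUPPLY is closed by name; sorry-free outside the stubs;
`MinimalTwinBSDTwo_of : …Theses.GenusKolyvaginAtTwo.MinimalTwinBSDTwo` has no hypothesis.  BSD is NOT proved by any of this.
-/

set_option linter.dupNamespace false -- `Summit.<P>.<Sub>` repeats `BirchSwinnertonDyer` (D-0017)

namespace Summit.BirchSwinnertonDyer.BirchSwinnertonDyer.Cruxes.MinimalTwinBSDTwo.TwinSwapV22

open scoped Classical NumberField

open Summit.BirchSwinnertonDyer.BirchSwinnertonDyer.Theses.GenusKolyvaginAtTwo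
open WeierstrassCurve NumberField Literature.NumberTheory.EllipticCurves Literature.NumberTheory.EllipticCurves.ModularForms
open Summit.BirchSwinnertonDyer.BirchSwinnertonDyer.Theorems
open Summit.BirchSwinnertonDyer.BirchSwinnertonDyer.Theorems.GenusExact.TwinSwap.Ledger.Line25 (rankZeroTwoConverse_of_items_of_offSemistable)
open Summit.BirchSwinnertonDyer.BirchSwinnertonDyer.Theorems.GenusExact.TwinSwap.AllDepth (bsdp_negDisc_of_wall_of_converse_of_exponent_of_facts)
open Summit.BirchSwinnertonDyer.BirchSwinnertonDyer.Theorems.GenusExact.TwinSwap.EggAllImages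
  (bsdp_posDisc_egg_of_wall_of_converse_of_exponent_of_facts_allImages)
open Summit.BirchSwinnertonDyer.BirchSwinnertonDyer.Theorems.GenusExact.TwinSwap.IdentityDoor (identityDoorSupplyAtTwo_allImages_of_GZK)
open Summit.BirchSwinnertonDyer.BirchSwinnertonDyer.Theorems.GenusExact.TwinSwap.IdentityDoorSha
  (bsdp_posDisc_offEgg_of_wall_of_converse_of_idSupply_of_expId_of_facts_allImages)
open Literature.NumberTheory.EllipticCurves.Rank1Residual (GoodOrd Mult)
open Summit.BirchSwinnertonDyer.BirchSwinnertonDyer.Theses.TwoAdicConverse (GoodOrdinaryRankZeroTwoConverse MultiplicativeRankZeroTwoConverse)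
open Summit.BirchSwinnertonDyer.Rank1Residual.F1Sign2 (MeetsEgg NoRationalTwoTorsion ShaTwoTrivial selmerGroupRelaxedAtInfinityAtTwo)
open Summit.BirchSwinnertonDyer.BirchSwinnertonDyer.Theses.ByReductionTypeAtTwo
  (GoodOrdinaryRankZeroAtTwo MultiplicativeRankZeroAtTwo SupersingularRankZeroAtTwo AdditiveRankZeroAtTwo)

/-! ## The displayed Props (texts VERBATIM from the landed ledgers; no new mathematics) -/

/-- S1 · the swapped ANCHOR (verbatim v1.1–v1.8): BSD₂ for non-CM curves of analytic rank 0 with trivial 2-Selmer group. -/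
def MinimalRankZeroBSDTwo : Prop :=
  ∀ (W : WeierstrassCurve ℚ) [W.IsElliptic] [W.IsGloballyMinimal],
    ¬ W.HasCM → W.analyticRank = 0 → Nat.card (W.selmerGroup 2) = 1 →
      Literature.NumberTheory.EllipticCurves.BSDp W 2

/-- EXP⁺_all (v2.0 = gk2-p3 g31's IMAGE-FREE text, p777498): on the egg (`Δ > 0`, `MeetsEgg`), at EVERY Tamagawa depth, at EVERY silent prime Heegner field
`ℚ(√−ℓ)` with `L(W^{(−ℓ)},1) ≠ 0` and EVERY conductor-`1` datum, **`2^{ord₂ c + ord₂ C(W)} ∥ P(1)`**.  The BSD₂ content there; LOSSLESS at each depth. -/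
def EXPPosAllDepth : Prop :=
  ∀ (W : WeierstrassCurve ℚ) [W.IsElliptic] [W.IsGloballyMinimal] [NeZero (W.conductorNorm ℤ)],
    ¬ W.HasCM → W.analyticRank = 1 → Nat.card (W.selmerGroup 2) = 2 → 0 < W.Δ → MeetsEgg W →
    ∀ (K : Type) [Field K] [NumberField K], IsImaginaryQuadratic K →
      ∀ (ℓ : ℕ), ℓ.Prime → NumberField.discr K = -(ℓ : ℤ) →
      (∀ x : ZMod ℓ, 4 * x ^ 3 + ((integralModelInt W).b₂ : ZMod ℓ) * x ^ 2 +
          2 * ((integralModelInt W).b₄ : ZMod ℓ) * x + ((integralModelInt W).b₆ : ZMod ℓ) ≠ 0) →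
      Odd (NumberField.discr K) → NumberField.discr K ≠ -3 → SatisfiesHeegnerHypothesis (W.conductorNorm ℤ) K →
      (W.quadraticTwist (NumberField.discr K : ℚ)).entireLFunction 1 ≠ 0 →
      ∀ (Dt : ModularParametrizationData W (W.conductorNorm ℤ)) (β : ℤ) (ι : K →+* ℂ) (d₁ : KolyvaginHeegnerData Dt β ι 1),
        (∃ Q : (W.baseChange (ringClassField K ι 1)).toAffine.Point,
          ((2 ^ (padicValInt 2 Dt.c + padicValNat 2 W.tamagawaProduct) : ℕ) : ℤ) • Q = d₁.derivedPoint) ∧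
        (¬ ∃ Q : (W.baseChange (ringClassField K ι 1)).toAffine.Point,
          ((2 ^ (padicValInt 2 Dt.c + padicValNat 2 W.tamagawaProduct + 1) : ℕ) : ℤ) • Q = d₁.derivedPoint)

/-- EXP⁻_all (verbatim v1.8): on `Δ < 0` (ANY `C(W)`, no image hypothesis), at EVERY door-open prime Heegner field `ℚ(√−ℓ)` (`Sel₂(W) ⊄ strictLocalKer_ℓ`,
`2` split) with `L(W^{(−ℓ)},1) ≠ 0` and EVERY conductor-`1` datum, **`2^{ord₂ c + ord₂ C(W)} ∥ P(1)`**.  The BSD₂ content; LOSSLESS at each depth. -/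
def EXPNegAllDepth : Prop :=
  ∀ (W : WeierstrassCurve ℚ) [W.IsElliptic] [W.IsGloballyMinimal] [NeZero (W.conductorNorm ℤ)],
    ¬ W.HasCM → W.analyticRank = 1 → Nat.card (W.selmerGroup 2) = 2 → W.Δ < 0 →
    ∀ (K : Type) [Field K] [NumberField K], IsImaginaryQuadratic K →
      ∀ (ℓ : ℕ) [Fact ℓ.Prime], NumberField.discr K = -(ℓ : ℤ) → ¬ W.selmerGroup 2 ≤ MazurRubin2010.strictLocalKer W ℚ_[ℓ] 2 →
      Odd (NumberField.discr K) → NumberField.discr K ≠ -3 → SatisfiesHeegnerHypothesis (W.conductorNorm ℤ) K →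
      ((Ideal.span {(2 : ℤ)}).primesOver (𝓞 K)).ncard = 2 →
      (W.quadraticTwist (NumberField.discr K : ℚ)).entireLFunction 1 ≠ 0 →
      ∀ (Dt : ModularParametrizationData W (W.conductorNorm ℤ)) (β : ℤ) (ι : K →+* ℂ) (d₁ : KolyvaginHeegnerData Dt β ι 1),
        (∃ Q : (W.baseChange (ringClassField K ι 1)).toAffine.Point,
          ((2 ^ (padicValInt 2 Dt.c + padicValNat 2 W.tamagawaProduct) : ℕ) : ℤ) • Q = d₁.derivedPoint) ∧
        (¬ ∃ Q : (W.baseChange (ringClassField K ι 1)).toAffine.Point,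
          ((2 ^ (padicValInt 2 Dt.c + padicValNat 2 W.tamagawaProduct + 1) : ℕ) : ℤ) • Q = d₁.derivedPoint)

/-- IDSUPPLY (v2.1: ALL IMAGES; A THEOREM modulo GZK — `IdentityDoor.identityDoorSupplyAtTwo_allImages_of_GZK`, see `identityDoorSupplyAtTwo_of_GZK'` below) ·
THE IDENTITY-DOOR SUPPLY — a ČEBOTAREV statement (Mazur–Rubin twisting primes for the TWO classes of `Sel₂^{rel ∞}(W)`; NO `L`-value, NO Heegner point): for `W` non-CM
with `r_an = 1`, `#Sel₂(W) = 2`, `Δ > 0`, `W(ℚ) ⊂ W⁰(ℝ)` (no image hypothesis): an imaginary quadratic `K = ℚ(√−ℓ)` (`ℓ` prime, `d_K = −ℓ` odd `≠ −3`, Heegner for `N_W`, `2` split) such that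
`ℓ` is an IDENTITY prime (`#W(ℚ_ℓ)[2] = 4`) at which `Sel₂^{rel ∞}(W)` has no non-zero class in `strictLocalKer_ℓ`, and a globally minimal model `Wd` of
`W^{(d_K)}`.  With it `#Sel₂(Wd) = 1` is a THEOREM (`IdentityDoor.natCard_selmerGroup_twin_eq_one_of_identityDoor`). -/
def IdentityDoorSupplyAtTwo : Prop :=
  ∀ (W : WeierstrassCurve ℚ) [W.IsElliptic] [W.IsGloballyMinimal] [NeZero (W.conductorNorm ℤ)],
    ¬ W.HasCM → W.analyticRank = 1 → Nat.card (W.selmerGroup 2) = 2 → 0 < W.Δ → ¬ MeetsEgg W →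
    ∃ (K : Type) (_ : Field K) (_ : NumberField K) (ℓ : ℕ) (_ : Fact ℓ.Prime),
      IsImaginaryQuadratic K ∧ NumberField.discr K = -(ℓ : ℤ) ∧
      Nat.card {Q : (W.baseChange ℚ_[ℓ]).toAffine.Point // 2 • Q = 0} = 4 ∧
      (∀ c ∈ selmerGroupRelaxedAtInfinityAtTwo W, c ∈ MazurRubin2010.strictLocalKer W ℚ_[ℓ] 2 → c = 0) ∧
      Odd (NumberField.discr K) ∧ NumberField.discr K ≠ -3 ∧ SatisfiesHeegnerHypothesis (W.conductorNorm ℤ) K ∧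
      ((Ideal.span {(2 : ℤ)}).primesOver (𝓞 K)).ncard = 2 ∧
      ∃ (Wd : WeierstrassCurve ℚ) (_ : Wd.IsElliptic) (_ : Wd.IsGloballyMinimal),
        ∃ C : VariableChange ℚ, C • W.quadraticTwist (NumberField.discr K : ℚ) = Wd

/-- EXP_id (v2.2; replaces KEX_id of v2.0/v2.1) · THE EXACT 2-ADIC DEPTH OF THE HEEGNER POINT ON THE `Δ > 0` OFF-EGG LOCUS: for `W` as in IDSUPPLY,
at EVERY identity-door prime Heegner field `K` (identity prime `ℓ`, `Sel₂^{rel ∞}(W)` injective at `ℓ`, `d_K = −ℓ` odd `≠ −3`, Heegner, `2` split)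
with `L(W^{(d_K)},1) ≠ 0` and EVERY conductor-`1` datum, **`2^{ord₂ c + ord₂ C(W) + 1} ∥ P(1)`**.  Equivalent to v2.1's KEX_id because
`#Ш(W_K)[2^∞] = 4` there is a THEOREM (`IdentityDoorSha.natCard_selmerGroup_baseChange_eq_eight_and_sha_of_identityDoor`); the BSD₂ content of the
locus; LOSSLESS (`IdentityDoorSha.twoDivExponent_eq_succ_of_bsdp_of_identityDoor`).  Same shape as EXP±_all, one bit deeper. -/
def EXPIdentityLocus : Prop :=
  ∀ (W : WeierstrassCurve ℚ) [W.IsElliptic] [W.IsGloballyMinimal] [NeZero (W.conductorNorm ℤ)],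
    ¬ W.HasCM → W.analyticRank = 1 → Nat.card (W.selmerGroup 2) = 2 → 0 < W.Δ → ¬ MeetsEgg W →
    ∀ (K : Type) [Field K] [NumberField K], IsImaginaryQuadratic K →
      ∀ (ℓ : ℕ) [Fact ℓ.Prime], NumberField.discr K = -(ℓ : ℤ) →
      Nat.card {Q : (W.baseChange ℚ_[ℓ]).toAffine.Point // 2 • Q = 0} = 4 →
      (∀ c ∈ selmerGroupRelaxedAtInfinityAtTwo W, c ∈ MazurRubin2010.strictLocalKer W ℚ_[ℓ] 2 → c = 0) →
      Odd (NumberField.discr K) → NumberField.discr K ≠ -3 → SatisfiesHeegnerHypothesis (W.conductorNorm ℤ) K →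
      ((Ideal.span {(2 : ℤ)}).primesOver (𝓞 K)).ncard = 2 →
      (W.quadraticTwist (NumberField.discr K : ℚ)).entireLFunction 1 ≠ 0 →
      ∀ (Dt : ModularParametrizationData W (W.conductorNorm ℤ)) (β : ℤ) (ι : K →+* ℂ) (d₁ : KolyvaginHeegnerData Dt β ι 1),
        (∃ Q : (W.baseChange (ringClassField K ι 1)).toAffine.Point,
          ((2 ^ (padicValInt 2 Dt.c + padicValNat 2 W.tamagawaProduct + 1) : ℕ) : ℤ) • Q = d₁.derivedPoint) ∧
        (¬ ∃ Q : (W.baseChange (ringClassField K ι 1)).toAffine.Point,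
          ((2 ^ (padicValInt 2 Dt.c + padicValNat 2 W.tamagawaProduct + 1 + 1) : ℕ) : ℤ) • Q = d₁.derivedPoint)

/-- CONV₀-residual · declared RESIDUAL (verbatim v1.7/v1.8, gk2-p3 g30's text): the rank-zero `2`-converse OFF the semistable-ordinary locus at `2`. -/
def RankZeroTwoConverseOffSemistableAtTwo : Prop :=
  ∀ (V : WeierstrassCurve ℚ) [V.IsElliptic] [V.IsGloballyMinimal], ¬ V.HasCM → ¬ (GoodOrd V 2 ∨ Mult V 2) →
    V.selmerCorank 2 = 0 → V.analyticRank = 0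

/-! ## The seven stubs (WALL row 1 ×4 bundled · CONV₀ items ×2 bundled · CONV₀ off-semistable residual · EXP⁻_all · EXP⁺_all · EXP_id · PRINT ×5 bundled) -/

/-- stub WALL = items `GoodOrdinaryRankZeroAtTwo` (stmt-BirchSwinnertonDyer-19095), `MultiplicativeRankZeroAtTwo`, `SupersingularRankZeroAtTwo`,
`AdditiveRankZeroAtTwo` (route ByReductionTypeAtTwo, WALL row 1) BY NAME — the anchor. -/
theorem stub_wallRankZeroAtTwo :
    GoodOrdinaryRankZeroAtTwo ∧ MultiplicativeRankZeroAtTwo ∧ SupersingularRankZeroAtTwo ∧ AdditiveRankZeroAtTwo := by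
  sorry

/-- stub CONV₀ = items stmt-BirchSwinnertonDyer-19218 `GoodOrdinaryRankZeroTwoConverse` and stmt-19219 `MultiplicativeRankZeroTwoConverse` (route
TwoAdicConverse) BY NAME. -/
theorem stub_rankZeroTwoConverseItems : GoodOrdinaryRankZeroTwoConverse ∧ MultiplicativeRankZeroTwoConverse := by
  sorry

/-- stub CONV₀-residual (DECLARED residual: rank-zero `2`-converse off the semistable-ordinary locus at `2`; nobody's item). -/
theorem stub_rankZeroTwoConverseOffSemistable : RankZeroTwoConverseOffSemistableAtTwo := by
  sorry

/-- stub EXP⁺_all — the 2-adic exponent of `y_K` on the egg at every depth (image-free); research content (= BSD₂ there mod the rest, lossless). -/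
theorem stub_expPosAllDepth : EXPPosAllDepth := by
  sorry

/-- stub EXP⁻_all — the 2-adic exponent of `y_K` on `Δ < 0` at every depth; research content (= BSD₂ there mod the rest, lossless). -/
theorem stub_expNegAllDepth : EXPNegAllDepth := by
  sorry

/-- stub EXP_id — the exact 2-adic depth `ord₂ c + ord₂ C(W) + 1` of the Heegner point on the identity locus; research content (= BSD₂ there mod the rest, lossless). -/
theorem stub_expIdentity : EXPIdentityLocus := by
  sorry

/-- stub PRINT = the route's four print items BY NAME — `GrossZagierAllLevels` (24148), `MultPublishedInputsAtTwo` (19921 = GZK), `EntireLFunctionRat` (19273),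
`MilneAnyModel` (24149) — and the modular parametrisation existence `nonempty_modularParametrizationData` (BCDT 2001 Thm. A; Literature statement-only fact). -/
theorem stub_printFacts :
    GrossZagierAllLevels ∧ MultPublishedInputsAtTwo ∧ EntireLFunctionRat ∧ MilneAnyModel ∧ nonempty_modularParametrizationData := by
  sorry

/-! ## The closed piece: the S1 door -/

/-- P1 door (critic #414, verbatim v1.1): WALL row 1 (ByReductionTypeAtTwo 19095–19098) ⟹ S1, by the reduction-type tetrachotomy at `2`. -/
theorem minimalRankZeroBSDTwo_of_wall (hOrd : GoodOrdinaryRankZeroAtTwo) (hMult : MultiplicativeRankZeroAtTwo)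
    (hSS : SupersingularRankZeroAtTwo) (hAdd : AdditiveRankZeroAtTwo) : MinimalRankZeroBSDTwo := by
  intro W _ _ hCM hr _hSel
  by_cases hg : W.HasGoodReductionAtPrime 2
  · by_cases hd : ((2 : ℕ) : ℤ) ∣ W.frobeniusTrace 2
    · exact hSS W hCM hr ⟨hg, hd⟩
    · exact hOrd W hCM hr ⟨hg, hd⟩
  · by_cases hm : W.HasMultiplicativeReductionAtPrime 2
    · exact hMult W hCM hr hm
    · exact hAdd W hCM hr ⟨hg, hm⟩

/-- IDSUPPLY is CLOSED modulo the print item GZK (`MultPublishedInputsAtTwo` = `rank_eq_analyticRank_of_analyticRank_le_one`): this seat's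
`IdentityDoor.identityDoorSupplyAtTwo_allImages_of_GZK` (`E(ℚ)[2] = 0` from rank `1` + `#Sel₂ = 2`; all-images Čebotarev for two classes + prime Heegner field + identity count +
global minimal model), text VERBATIM. -/
theorem identityDoorSupplyAtTwo_of_GZK' (hGZK : MultPublishedInputsAtTwo) : IdentityDoorSupplyAtTwo :=
  fun W _ _ _ ↦ identityDoorSupplyAtTwo_allImages_of_GZK hGZK W

/-! ## The composition -/

/-- COMPOSITION v2.2 with displayed inputs (kernel-checked, no sorry of its own): S1 + CONV₀ (19218, 19219, off-semistable residual) + EXP⁻_all + EXP⁺_all +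
IDSUPPLY + EXP_id + PRINT×5 prove hTw BY NAME, by the EXHAUSTIVE trichotomy `Δ < 0` (`AllDepth.bsdp_negDisc_of_wall_of_converse_of_exponent_of_facts`, every curve) ∨
`Δ > 0 ∧ MeetsEgg` (`EggAllImages.bsdp_posDisc_egg_…_allImages`, every curve) ∨ `Δ > 0 ∧ ¬MeetsEgg` (THE IDENTITY DOOR, all images:
`IdentityDoorSha.bsdp_posDisc_offEgg_of_wall_of_converse_of_idSupply_of_expId_of_facts_allImages`).  No residual. -/
theorem minimalTwinBSDTwo_of_inputs (h1 : MinimalRankZeroBSDTwo) (hC0g : GoodOrdinaryRankZeroTwoConverse)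
    (hC0m : MultiplicativeRankZeroTwoConverse) (hC0r : RankZeroTwoConverseOffSemistableAtTwo) (hEXPneg : EXPNegAllDepth)
    (hEXPpos : EXPPosAllDepth) (hIDS : IdentityDoorSupplyAtTwo) (hEXPid : EXPIdentityLocus)
    (hGZ : GrossZagierAllLevels) (hGZK : MultPublishedInputsAtTwo) (hL : EntireLFunctionRat) (hMi : MilneAnyModel)
    (hMP : nonempty_modularParametrizationData) :
    -- (= `MinimalTwinBSDTwo` unfolded, so that `MinimalTwinBSDTwo_of` below is the FIRST theorem concluding the crux decl by name)
    ∀ (W : WeierstrassCurve ℚ) [W.IsElliptic] [W.IsGloballyMinimal],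
      ¬ W.HasCM → W.analyticRank = 1 → Nat.card (W.selmerGroup 2) = 2 → Literature.NumberTheory.EllipticCurves.BSDp W 2 := by
  -- the rank-zero 2-converse on all non-CM curves from the two items + the off-semistable residual (p775371)
  have hC0 := rankZeroTwoConverse_of_items_of_offSemistable hC0g hC0m hC0r
  intro W _ _ hcm hr hSel
  -- an elliptic curve has `Δ ≠ 0`
  have hΔ : W.Δ ≠ 0 := by rw [← WeierstrassCurve.coe_Δ']; exact W.Δ'.ne_zero
  rcases lt_or_gt_of_ne hΔ with hneg | hpos
  · -- `Δ < 0`: every curve — S1 + CONV₀ + EXP⁻_all + PRINT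
    exact bsdp_negDisc_of_wall_of_converse_of_exponent_of_facts hGZ hGZK hL hMi hMP h1 hC0 hEXPneg W hcm hr hSel hneg
  · by_cases hegg : MeetsEgg W
    · -- the egg, every depth, every image — S1 + CONV₀ + EXP⁺_all + PRINT
      exact bsdp_posDisc_egg_of_wall_of_converse_of_exponent_of_facts_allImages hGZ hGZK hL hMi hMP h1 hC0 hEXPpos W hcm hr hSel hpos hegg
    · -- THE IDENTITY DOOR, every image — S1 + CONV₀ + IDSUPPLY + EXP_id + PRINT
      exact bsdp_posDisc_offEgg_of_wall_of_converse_of_idSupply_of_expId_of_facts_allImages hGZ hGZK hL hMi hMP h1 hC0 hIDS hEXPid W hcm hr hSel hpos hegg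

/-- **THE LINE CONCLUDES THE CRUX BY NAME**: `MinimalTwinBSDTwo` (stmt-BirchSwinnertonDyer-22985) from the seven stubs — WALL row 1 (items, bundled), CONV₀
(items 19218 ∧ 19219, bundled), CONV₀ off-semistable residual, EXP⁻_all, EXP⁺_all, EXP_id, PRINT×5 (bundled) — the identity-door supply being the
THEOREM `identityDoorSupplyAtTwo_of_GZK'` fed with the GZK conjunct of PRINT.  Sorry-free outside the stubs; no residual locus. -/
theorem MinimalTwinBSDTwo_of : Summit.BirchSwinnertonDyer.BirchSwinnertonDyer.Theses.GenusKolyvaginAtTwo.MinimalTwinBSDTwo :=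
  minimalTwinBSDTwo_of_inputs
    (minimalRankZeroBSDTwo_of_wall stub_wallRankZeroAtTwo.1 stub_wallRankZeroAtTwo.2.1 stub_wallRankZeroAtTwo.2.2.1
      stub_wallRankZeroAtTwo.2.2.2)
    stub_rankZeroTwoConverseItems.1 stub_rankZeroTwoConverseItems.2 stub_rankZeroTwoConverseOffSemistable
    stub_expNegAllDepth stub_expPosAllDepth (identityDoorSupplyAtTwo_of_GZK' stub_printFacts.2.1) stub_expIdentity
    stub_printFacts.1 stub_printFacts.2.1 stub_printFacts.2.2.1 stub_printFacts.2.2.2.1 stub_printFacts.2.2.2.2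

end Summit.BirchSwinnertonDyer.BirchSwinnertonDyer.Cruxes.MinimalTwinBSDTwo.TwinSwapV22
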